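import Summits.HodgeConjecture.HodgeConjecture.Theorems.Q8SymplecticPowersQuaternionicSliceSpan
import Summits.HodgeConjecture.HodgeConjecture.Theorems.Q8SymplecticPowersBlockSlices
import Summits.HodgeConjecture.HodgeConjecture.Theorems.Q8SymplecticPowersBlockExtension
import Summits.HodgeConjecture.HodgeConjecture.Theorems.Q8SymplecticPowersCentraliserInvariance
import Literature.RepresentationTheory.ClassicalInvariants.SymplecticInvolutionTensorFFT
import HarnessLib

/-!
# Route `Q8SymplecticPowers`, programme K2Q ∕ F-Q — brick F2c-2: **a rational tensor of `T^{r,0}(V)` fixed by the block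
# extensions `id_N ⊕ [k₁, k₂]` of the commutators of the quaternionic-unitary centraliser of `T` is a `ℚ`-combination of
# QUATERNIONIC MATCHING TENSORS WITH FREE SLOTS**

Support file for crux K2Q `PowersHodgeOfQuaternionCommutators` (stmt-HodgeConjecture-24191; `--supports … --as helper`;
nothing here closes an item). Prover seat `hodge-nonav-20241-p1` (g21). Pure linear algebra over `ℚ`.

Setting (abstracting `V = H²(X; ℚ)`, `N = Hdg¹`, `T = Hdg¹^⊥`, `a = τ^*`, `b = j^*`, `Q = tr ∘ cup`): `V = N ⊕ T`, `Q(N, T) = 0`,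
`Q|_T` nondegenerate and symmetric, `a, b` preserve `T` and satisfy the quaternion table on `T` (`a² = b² = −1`, `ab = −ba`) and
are `Q`-isometries on `T`.  **`mem_span_matching_of_commutator_invariant`**: a tensor `t ∈ T^{r,0}(V)` fixed by
`id_N ⊕ (k₁k₂k₁⁻¹k₂⁻¹)` for all `k₁, k₂ ∈ GL(T)` commuting with `a|_T, b|_T` and preserving `Q|_T` lies in the `ℚ`-span of the
tensors `Σ_w (∏_c Θ_c(w p_c, w q_c)) (∏_a ζ_a(w s_a)) · ⊗_i bV(w i)` (any basis `bV` of `V`), for matchings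
`ε : Fin r ≃ (Fin 2 × Fin j) ⊕ Fin l`, pair matrices `Θ_c = P · (0 ⊕ D_T G_T⁻¹) · Pᵀ` (`D ∈ {1, a, b, ab}` restricted to `T`,
`G_T` the Gram matrix of `Q|_T`, `P` the matrix of the adapted basis `bN ⊔ bT` in `bV`) and free vectors `ζ_a = bV.repr z_a`,
`z_a ∈ N`.

Proof: coordinates `c` of `t` in the adapted basis (`ClassicalInvariants.coord`); the matrix of `id_N ⊕ k` there is
`fromBlocks 1 0 0 [k]` (§1), so `c` is fixed by these Kronecker powers (`coord_invariant`); every `N`-profile slice of `c` is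
then fixed by the commutators of the rational points of the matrix centraliser (brick F2b `slice_invariant_fin`), hence a
`ℚ`-combination of quaternionic tagged contractions (brick F2c-1 = ASC-Q + F1D + descent); the slices reassemble into matching
coefficient tensors with free slots (F2b), and the change of basis to `bV` is brick F2a's `sum_prod_mul_matchingFree`.

HONEST FRAMING: linear algebra only (axioms standard); item 24191 OPEN; nothing here says HC ∕ HC_CM ∕ HC_AV is proved.

## References

* R. Goodman, N. Wallach, *Symmetry, Representations, and Invariants*, GTM 255, §4.2.2 Prop. 4.2.5, §5.3.2 Thm. 5.3.3,
  §11.2. [cite: GoodmanWallachGTM255]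
-/

set_option linter.dupNamespace false

noncomputable section

open Module Matrix
open scoped BigOperators Matrix TensorProduct

namespace Summit.HodgeConjecture.HodgeConjecture.Theorems.Q8SymplecticPowersQuaternionicInvariantsMatching

open Literature.AlgebraicGeometry.Motives (hodgeTensorSpace tensorSpaceAct)
open Literature.RepresentationTheory.ClassicalInvariants (taggedContraction basisMonomial synth coord synth_coord synth_apply
  coord_invariant tprod_sum_smul_tmul toMatrix_eq_of toMatrix_toLinearEquiv isometry_toLinearEquiv comm_toLinearEquiv)
open Literature.NumberTheory.DiophantineGeometry (tensorPowerMatrix tensorPowerMatrix_apply)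
open Summit.HodgeConjecture.HodgeConjecture.Theorems.Q8SymplecticPowersBlockSlices (join slice_invariant_fin
  eq_sum_sum_smul_indicator sum_smul_indicator_mem_span sum_taggedContraction_smul_indicator)
open Summit.HodgeConjecture.HodgeConjecture.Theorems.Q8SymplecticPowersBlockExtension (blockExtend blockExtend_apply_left
  blockExtend_apply_right blockExtend_commutator)
open Summit.HodgeConjecture.HodgeConjecture.Theorems.Q8SymplecticPowersCentraliserInvariance (toMatrix_mul_equiv toMatrix_one_equiv)
open Summit.HodgeConjecture.HodgeConjecture.Theorems.Q8SymplecticPowersMatchingFreeSlots (sum_prod_mul_matchingFree)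
open Summit.HodgeConjecture.HodgeConjecture.Theorems.Q8SymplecticPowersQuaternionicSliceSpan (mem_span_taggedContraction_rat)

universe u

variable {V : Type u} [AddCommGroup V] [Module ℚ V]

/-! ### §1 The adapted basis `bN ⊔ bT` and the matrix of `id_N ⊕ k` -/

section Adapted

variable {N T : Submodule ℚ V} (hNT : IsCompl N T) {ιN ιT : Type*} (bN : Basis ιN ℚ N) (bT : Basis ιT ℚ T)

/-- The adapted basis on an `N`-index is the `N`-vector. [folklore] -/
theorem adapted_apply_inl (k : ιN) :
    ((bN.prod bT).map (Submodule.prodEquivOfIsCompl N T hNT)) (Sum.inl k) = (bN k : V) := by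
  rw [Basis.map_apply, Basis.prod_apply, Sum.elim_inl, Function.comp_apply, LinearMap.inl_apply,
    Submodule.coe_prodEquivOfIsCompl', Submodule.coe_zero, add_zero]

/-- The adapted basis on a `T`-index is the `T`-vector. [folklore] -/
theorem adapted_apply_inr (k : ιT) :
    ((bN.prod bT).map (Submodule.prodEquivOfIsCompl N T hNT)) (Sum.inr k) = (bT k : V) := by
  rw [Basis.map_apply, Basis.prod_apply, Sum.elim_inr, Function.comp_apply, LinearMap.inr_apply,
    Submodule.coe_prodEquivOfIsCompl', Submodule.coe_zero, zero_add]

/-- Coordinates in the adapted basis. [folklore] -/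
theorem adapted_repr (v : V) (s : ιN ⊕ ιT) :
    ((bN.prod bT).map (Submodule.prodEquivOfIsCompl N T hNT)).repr v s =
      (bN.prod bT).repr ((Submodule.prodEquivOfIsCompl N T hNT).symm v) s := by
  rw [Basis.map_repr, LinearEquiv.trans_apply]

variable [Fintype ιN] [Fintype ιT] [DecidableEq ιN] [DecidableEq ιT]

/-- **The matrix of `id_N ⊕ k` in the adapted basis is `fromBlocks 1 0 0 [k]_{bT}`.** [cite: GoodmanWallachGTM255, §4.2.2 Prop. 4.2.5] -/
theorem toMatrix_blockExtend (k : T ≃ₗ[ℚ] T) :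
    LinearMap.toMatrix ((bN.prod bT).map (Submodule.prodEquivOfIsCompl N T hNT))
        ((bN.prod bT).map (Submodule.prodEquivOfIsCompl N T hNT)) (blockExtend hNT k : V →ₗ[ℚ] V) =
      Matrix.fromBlocks 1 0 0 (LinearMap.toMatrix bT bT (k : T →ₗ[ℚ] T)) := by
  ext x y
  rw [LinearMap.toMatrix_apply, LinearEquiv.coe_coe, adapted_repr]
  rcases y with y | y
  · rw [adapted_apply_inl, blockExtend_apply_left, Submodule.prodEquivOfIsCompl_symm_apply_left]
    rcases x with x | x
    · rw [Basis.prod_repr_inl, Basis.repr_self, Matrix.fromBlocks_apply₁₁, Finsupp.single_apply, Matrix.one_apply]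
      exact if_congr eq_comm rfl rfl
    · rw [Basis.prod_repr_inr, map_zero, Finsupp.zero_apply, Matrix.fromBlocks_apply₂₁, Matrix.zero_apply]
  · rw [adapted_apply_inr, blockExtend_apply_right, Submodule.prodEquivOfIsCompl_symm_apply_right]
    rcases x with x | x
    · rw [Basis.prod_repr_inl, map_zero, Finsupp.zero_apply, Matrix.fromBlocks_apply₁₂, Matrix.zero_apply]
    · rw [Basis.prod_repr_inr, Matrix.fromBlocks_apply₂₂, LinearMap.toMatrix_apply, LinearEquiv.coe_coe]

end Adapted

/-- The matrix of an inverse automorphism. [folklore] -/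
theorem toMatrix_inv_equiv {W : Type*} [AddCommGroup W] [Module ℚ W] {n : ℕ} (β : Basis (Fin n) ℚ W) (g : W ≃ₗ[ℚ] W) :
    LinearMap.toMatrix β β ((g⁻¹ : W ≃ₗ[ℚ] W) : W →ₗ[ℚ] W) = (LinearMap.toMatrix β β (g : W →ₗ[ℚ] W))⁻¹ := by
  symm
  apply Matrix.inv_eq_left_inv
  rw [← toMatrix_mul_equiv, inv_mul_cancel, toMatrix_one_equiv]

/-- The matrix of a commutator of automorphisms. [folklore] -/
theorem toMatrix_commutator_equiv {W : Type*} [AddCommGroup W] [Module ℚ W] {n : ℕ} (β : Basis (Fin n) ℚ W)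
    (g h : W ≃ₗ[ℚ] W) :
    LinearMap.toMatrix β β ((g * h * g⁻¹ * h⁻¹ : W ≃ₗ[ℚ] W) : W →ₗ[ℚ] W) =
      LinearMap.toMatrix β β (g : W →ₗ[ℚ] W) * LinearMap.toMatrix β β (h : W →ₗ[ℚ] W) *
        (LinearMap.toMatrix β β (g : W →ₗ[ℚ] W))⁻¹ * (LinearMap.toMatrix β β (h : W →ₗ[ℚ] W))⁻¹ := by
  rw [toMatrix_mul_equiv, toMatrix_mul_equiv, toMatrix_mul_equiv, toMatrix_inv_equiv, toMatrix_inv_equiv]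

/-! ### §2 The theorem -/

/-- **Brick F2c-2.** See the file header. [cite: GoodmanWallachGTM255, §5.3.2 Thm. 5.3.3, §4.2.2 Prop. 4.2.5 and §11.2] -/
theorem mem_span_matching_of_commutator_invariant
    (Q : LinearMap.BilinForm ℚ V) (hQs : ∀ x y, Q x y = Q y x) (a b : V →ₗ[ℚ] V)
    {N T : Submodule ℚ V} (hNT : IsCompl N T) (haT : ∀ x ∈ T, a x ∈ T) (hbT : ∀ x ∈ T, b x ∈ T)
    (hQT : (Q.restrict T).Nondegenerate)
    (haa : ∀ x ∈ T, a (a x) = -x) (hbb : ∀ x ∈ T, b (b x) = -x) (hab : ∀ x ∈ T, a (b x) = -(b (a x)))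
    (haQ : ∀ x ∈ T, ∀ y ∈ T, Q (a x) (a y) = Q x y) (hbQ : ∀ x ∈ T, ∀ y ∈ T, Q (b x) (b y) = Q x y)
    {nN nT : ℕ} (bN : Basis (Fin nN) ℚ N) (bT : Basis (Fin nT) ℚ T)
    {ι : Type*} [Fintype ι] [DecidableEq ι] (bV : Basis ι ℚ V) (r : ℕ) (t : hodgeTensorSpace V r 0)
    (ht : ∀ k₁ k₂ : T ≃ₗ[ℚ] T,
      (∀ x : T, (k₁ (a.restrict haT x) : V) = a (k₁ x)) → (∀ x : T, (k₁ (b.restrict hbT x) : V) = b (k₁ x)) →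
      (∀ x y : T, Q (k₁ x) (k₁ y) = Q x y) →
      (∀ x : T, (k₂ (a.restrict haT x) : V) = a (k₂ x)) → (∀ x : T, (k₂ (b.restrict hbT x) : V) = b (k₂ x)) →
      (∀ x y : T, Q (k₂ x) (k₂ y) = Q x y) →
      tensorSpaceAct (blockExtend hNT (k₁ * k₂ * k₁⁻¹ * k₂⁻¹)) t = t) :
    t ∈ Submodule.span ℚ {x : hodgeTensorSpace V r 0 | ∃ (j l : ℕ) (ε : Fin r ≃ (Fin 2 × Fin j) ⊕ Fin l) (δ : Fin j → Fin 4)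
      (z : Fin l → V) (_ : ∀ c, z c ∈ N),
      x = ∑ w : Fin r → ι,
        ((∏ c, ((Matrix.of fun i s => Sum.elim (fun k => bV.repr (bN k : V) i) (fun k => bV.repr (bT k : V) i) s) *
            Matrix.fromBlocks (0 : Matrix (Fin nN) (Fin nN) ℚ) 0 0
              ((![(1 : Matrix (Fin nT) (Fin nT) ℚ), LinearMap.toMatrix bT bT (a.restrict haT),
                  LinearMap.toMatrix bT bT (b.restrict hbT),
                  LinearMap.toMatrix bT bT (a.restrict haT) * LinearMap.toMatrix bT bT (b.restrict hbT)] : Fin 4 → _) (δ c) *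
                (Matrix.of fun k k' : Fin nT => Q (bT k) (bT k'))⁻¹) *
            (Matrix.of fun i s => Sum.elim (fun k => bV.repr (bN k : V) i) (fun k => bV.repr (bT k : V) i) s)ᵀ)
            (w (ε.symm (Sum.inl (0, c)))) (w (ε.symm (Sum.inl (1, c))))) *
          ∏ c', bV.repr (z c') (w (ε.symm (Sum.inr c')))) • basisMonomial bV r w} := by
  classical
  -- ### names
  set bA : Basis (Fin nN ⊕ Fin nT) ℚ V := (bN.prod bT).map (Submodule.prodEquivOfIsCompl N T hNT) with hbA
  set P : Matrix ι (Fin nN ⊕ Fin nT) ℚ :=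
    Matrix.of fun i s => Sum.elim (fun k => bV.repr (bN k : V) i) (fun k => bV.repr (bT k : V) i) s with hPdef
  set aT : T →ₗ[ℚ] T := a.restrict haT with haTdef
  set bT' : T →ₗ[ℚ] T := b.restrict hbT with hbTdef
  set ST : Matrix (Fin nT) (Fin nT) ℚ := LinearMap.toMatrix bT bT aT with hST
  set TT : Matrix (Fin nT) (Fin nT) ℚ := LinearMap.toMatrix bT bT bT' with hTT
  set GT : Matrix (Fin nT) (Fin nT) ℚ := Matrix.of fun k k' : Fin nT => Q (bT k) (bT k') with hGTdef
  set ΘT : Fin 4 → Matrix (Fin nT) (Fin nT) ℚ :=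
    fun d => (![(1 : Matrix (Fin nT) (Fin nT) ℚ), ST, TT, ST * TT] : Fin 4 → _) d * GT⁻¹ with hΘT
  have hP : ∀ i s, P i s = bV.repr (bA s) i := by
    intro i s
    rcases s with k | k
    · rw [hPdef, Matrix.of_apply, Sum.elim_inl, hbA, adapted_apply_inl]
    · rw [hPdef, Matrix.of_apply, Sum.elim_inr, hbA, adapted_apply_inr]
  -- ### the matrices `ST, TT, GT`
  have hGT : GT = LinearMap.BilinForm.toMatrix bT (Q.restrict T) := by
    rw [toMatrix_eq_of]; rfl
  have hSS : ST * ST = -1 := by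
    rw [hST, ← LinearMap.toMatrix_mul, show aT * aT = -1 from LinearMap.ext fun x => Subtype.ext (by
      simp only [Module.End.mul_apply, haTdef, LinearMap.coe_restrict_apply, LinearMap.neg_apply, Module.End.one_apply,
        Submodule.coe_neg]
      exact haa x x.2), map_neg, LinearMap.toMatrix_one]
  have hTT2 : TT * TT = -1 := by
    rw [hTT, ← LinearMap.toMatrix_mul, show bT' * bT' = -1 from LinearMap.ext fun x => Subtype.ext (by
      simp only [Module.End.mul_apply, hbTdef, LinearMap.coe_restrict_apply, LinearMap.neg_apply, Module.End.one_apply,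
        Submodule.coe_neg]
      exact hbb x x.2), map_neg, LinearMap.toMatrix_one]
  have hSTc : ST * TT = -(TT * ST) := by
    rw [hST, hTT, ← LinearMap.toMatrix_mul, ← LinearMap.toMatrix_mul, ← map_neg]
    congr 1
    refine LinearMap.ext fun x => Subtype.ext ?_
    simp only [Module.End.mul_apply, haTdef, hbTdef, LinearMap.coe_restrict_apply, LinearMap.neg_apply, Submodule.coe_neg]
    exact hab x x.2
  have hSG : STᵀ * GT * ST = GT := by
    rw [hGT, hST, ← LinearMap.BilinForm.toMatrix_comp bT]
    congr 1
    refine LinearMap.BilinForm.ext fun x y => ?_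
    rw [LinearMap.BilinForm.comp_apply]
    show Q (a x) (a y) = Q x y
    exact haQ x x.2 y y.2
  have hTG : TTᵀ * GT * TT = GT := by
    rw [hGT, hTT, ← LinearMap.BilinForm.toMatrix_comp bT]
    congr 1
    refine LinearMap.BilinForm.ext fun x y => ?_
    rw [LinearMap.BilinForm.comp_apply]
    show Q (b x) (b y) = Q x y
    exact hbQ x x.2 y y.2
  have hGt : GTᵀ = GT := by
    ext k k'
    rw [Matrix.transpose_apply, hGTdef, Matrix.of_apply, Matrix.of_apply, hQs]
  have hG : IsUnit GT.det := by
    rw [hGT, isUnit_iff_ne_zero]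
    exact (LinearMap.BilinForm.nondegenerate_iff_det_ne_zero bT).1 hQT
  -- ### from matrices of the centraliser to block extensions
  have hequiv : ∀ γ : Matrix (Fin nT) (Fin nT) ℚ, IsUnit γ.det → γ * ST = ST * γ → γ * TT = TT * γ → γᵀ * GT * γ = GT →
      ∃ k : T ≃ₗ[ℚ] T, LinearMap.toMatrix bT bT (k : T →ₗ[ℚ] T) = γ ∧
        (∀ x : T, (k (a.restrict haT x) : V) = a (k x)) ∧ (∀ x : T, (k (b.restrict hbT x) : V) = b (k x)) ∧
        (∀ x y : T, Q (k x) (k y) = Q x y) := by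
    intro γ hγ hγS hγT hγG
    refine ⟨Matrix.toLinearEquiv bT γ hγ, toMatrix_toLinearEquiv γ hγ, fun x => ?_, fun x => ?_, fun x y => ?_⟩
    · rw [comm_toLinearEquiv aT γ hγ (by rw [← hST]; exact hγS) x, haTdef, LinearMap.coe_restrict_apply]
    · rw [comm_toLinearEquiv bT' γ hγ (by rw [← hTT]; exact hγT) x, hbTdef, LinearMap.coe_restrict_apply]
    · exact isometry_toLinearEquiv (B := Q.restrict T) γ hγ (by rw [← hGT]; exact hγG) x y
  -- ### the coefficient tensor and its invariance under `fromBlocks 1 0 0 [γ₁, γ₂]`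
  set c : (Fin r → Fin nN ⊕ Fin nT) → ℚ := coord bA r t with hcdef
  have hc : ∀ γ₁ γ₂ : Matrix (Fin nT) (Fin nT) ℚ, IsUnit γ₁.det → IsUnit γ₂.det → γ₁ * ST = ST * γ₁ → γ₂ * ST = ST * γ₂ →
      γ₁ * TT = TT * γ₁ → γ₂ * TT = TT * γ₂ → γ₁ᵀ * GT * γ₁ = GT → γ₂ᵀ * GT * γ₂ = GT →
      ∀ w' : Fin r → Fin nN ⊕ Fin nT,
        (∑ w, (∏ p, Matrix.fromBlocks (1 : Matrix (Fin nN) (Fin nN) ℚ) 0 0 (γ₁ * γ₂ * γ₁⁻¹ * γ₂⁻¹) (w' p) (w p)) * c w) =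
          c w' := by
    intro γ₁ γ₂ h1 h2 h1S h2S h1T h2T h1G h2G w'
    obtain ⟨k₁, hk₁, hk₁a, hk₁b, hk₁Q⟩ := hequiv γ₁ h1 h1S h1T h1G
    obtain ⟨k₂, hk₂, hk₂a, hk₂b, hk₂Q⟩ := hequiv γ₂ h2 h2S h2T h2G
    have hinv := ht k₁ k₂ hk₁a hk₁b hk₁Q hk₂a hk₂b hk₂Q
    have hco := coord_invariant bA r _ t hinv w'
    rw [toMatrix_blockExtend, toMatrix_commutator_equiv, hk₁, hk₂] at hco
    exact hco
  -- ### every slice is a combination of quaternionic tagged contractions (F2b + F2c-1)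
  have hslice : ∀ (η : Fin r → Option (Fin nN)) {m : ℕ} (σ : Fin m ≃ {p // η p = none}),
      (fun v : Fin m → Fin nT => c (join η fun q => v (σ.symm q))) ∈
        Submodule.span ℚ {f : (Fin m → Fin nT) → ℚ | ∃ (j : ℕ) (e : Fin m ≃ Fin 2 × Fin j) (δ : Fin j → Fin 4),
          f = taggedContraction ΘT e δ} := by
    intro η m σ
    refine mem_span_taggedContraction_rat ST TT GT hSS hTT2 hSTc hSG hTG hGt hG _ ?_
    intro γ₁ γ₂ h1 h2 h1S h2S h1T h2T h1G h2G
    funext v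
    show (∑ v₂, tensorPowerMatrix ℚ nT m (γ₁ * γ₂ * γ₁⁻¹ * γ₂⁻¹) v v₂ * c (join η fun q => v₂ (σ.symm q))) = _
    simp only [tensorPowerMatrix_apply]
    exact slice_invariant_fin _ c (hc γ₁ γ₂ h1 h2 h1S h2S h1T h2T h1G h2G) η σ v
  -- ### reassembly: `c` is a combination of matching coefficient tensors with free slots
  have hcspan : c ∈ Submodule.span ℚ {f : (Fin r → Fin nN ⊕ Fin nT) → ℚ | ∃ (j l : ℕ) (ε : Fin r ≃ (Fin 2 × Fin j) ⊕ Fin l)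
      (δ : Fin j → Fin 4) (xN : Fin l → Fin nN),
      f = fun w => (∏ c, Matrix.fromBlocks (0 : Matrix (Fin nN) (Fin nN) ℚ) 0 0 (ΘT (δ c))
          (w (ε.symm (Sum.inl (0, c)))) (w (ε.symm (Sum.inl (1, c))))) *
        ∏ c', if w (ε.symm (Sum.inr c')) = Sum.inl (xN c') then (1 : ℚ) else 0} := by
    rw [eq_sum_sum_smul_indicator c (fun η => Fintype.card {p // η p = none}) (fun η => (Fintype.equivFin _).symm)]
    refine Submodule.sum_mem _ fun η _ => ?_
    refine Submodule.span_mono ?_ (sum_smul_indicator_mem_span η (Fintype.equivFin _).symm (hslice η (Fintype.equivFin _).symm))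
    rintro _ ⟨f, ⟨j, e, δ, rfl⟩, rfl⟩
    set σ : Fin (Fintype.card {p // η p = none}) ≃ {p // η p = none} := (Fintype.equivFin _).symm with hσ
    set τN : {p // ¬η p = none} ≃ Fin (Fintype.card {p // ¬η p = none}) := Fintype.equivFin _ with hτN
    refine ⟨j, Fintype.card {p // ¬η p = none},
      ((Equiv.sumCongr (e.symm.trans σ) τN.symm).trans (Equiv.sumCompl fun p => η p = none)).symm, δ,
      fun c' => Option.get (η (τN.symm c').1) (Option.ne_none_iff_isSome.mp (τN.symm c').2), ?_⟩
    beta_reduce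
    rw [sum_taggedContraction_smul_indicator ΘT η σ e τN δ]
    rfl
  -- ### synthesis and change of basis to `bV`
  have htsynth : t = synth bA r c := (synth_coord bA r t).symm
  rw [htsynth]
  have hmap := Submodule.mem_map_of_mem (f := synth bA r) hcspan
  rw [Submodule.map_span] at hmap
  refine Submodule.span_mono ?_ hmap
  rintro _ ⟨f, ⟨j, l, ε, δ, xN, rfl⟩, rfl⟩
  refine ⟨j, l, ε, δ, fun c' => (bN (xN c') : V), fun c' => (bN (xN c')).2, ?_⟩
  -- the basis monomials of `bA` in terms of those of `bV`
  have hmono : ∀ w : Fin r → Fin nN ⊕ Fin nT,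
      basisMonomial bA r w = ∑ w' : Fin r → ι, (∏ i, P (w' i) (w i)) • basisMonomial bV r w' := by
    intro w
    rw [← tprod_sum_smul_tmul bV r P w, basisMonomial]
    congr 2
    funext i
    conv_lhs => rw [← bV.sum_repr (bA (w i))]
    exact Finset.sum_congr rfl fun i' _ => by rw [hP]
  -- the free slots: `P *ᵥ δ_{inl k} = bV.repr (bN k)`
  have hfree : ∀ k : Fin nN, (P *ᵥ fun s => if s = Sum.inl k then (1 : ℚ) else 0) = ⇑(bV.repr (bN k : V)) := by
    intro k
    funext i
    rw [Matrix.mulVec, dotProduct, Finset.sum_eq_single_of_mem (Sum.inl k : Fin nN ⊕ Fin nT) (Finset.mem_univ _)]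
    · rw [if_pos rfl, mul_one, hP, hbA, adapted_apply_inl]
    · intro s _ hs
      rw [if_neg hs, mul_zero]
  rw [synth_apply]
  simp_rw [hmono, Finset.smul_sum, smul_smul]
  rw [Finset.sum_comm]
  refine Finset.sum_congr rfl fun w' _ => ?_
  rw [← Finset.sum_smul]
  congr 1
  have key := sum_prod_mul_matchingFree P (fun d => Matrix.fromBlocks (0 : Matrix (Fin nN) (Fin nN) ℚ) 0 0 (ΘT d)) ε δ
    (fun c' s => if s = Sum.inl (xN c') then (1 : ℚ) else 0) w'
  beta_reduce at key
  simp only [hfree] at key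
  exact (Finset.sum_congr rfl fun w _ => mul_comm _ _).trans key

end Summit.HodgeConjecture.HodgeConjecture.Theorems.Q8SymplecticPowersQuaternionicInvariantsMatching

end
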